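import Literature.NumberTheory.LFunctions.NymanBeurlingProofs
import Literature.NumberTheory.LFunctions.NymanBeurlingRate
import Mathlib.Analysis.SpecialFunctions.Integrals.Basic
import Summits.RiemannHypothesis.RiemannHypothesis.Theorems.NymanBeurlingTailKernel
import Mathlib.NumberTheory.ArithmeticFunction.Moebius
import HarnessLib

/-!
# RiemannHypothesis / Nyman–Beurling — TAIL LEVERAGE (RH-FREE per N): `(1 − 2 log²2)·tailConst(c)² ≤ ∫_0^1 f_c²`

Theory memo `theory/TARGETS.md` §8.2 (T1), cell `pub/rh-li`.  For every coefficient vector `c`, on `(1/2, 1]` the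
approximant `f_c(x) = Σ c_k {1/((k+1)x)}` equals `tailConst(c)/x − c_0` (only `ρ_1` has an integer part there), so
`∫_0^1 f_c² ≥ ∫_{1/2}^1 (τ/x − c_0)² ≥ min_d ∫_{1/2}^1 (τ/x − d)² = (1 − 2 log²2) τ²`, `τ = tailConst c`
(`nbTailLeverageBound`; hence the head form dominates the tail functional: `s_N ≤ 1/(1 − 2log²2) = 25.6`), and the
distance form `(2 − 2 log²2)·tailConst(c)² ≤ d_N²(c)` (`nbTailConstLeDist`, the `(1,∞)` tail adding `tailConst(c)²`).
Also (T6a) `nbLevinsonTailConst`: for the Levinson / Bettin–Conrey–Farmer vector `v_a = −μ(a)(1 − log a/log N)`,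
`tailConst(v_N) = −(1/log N) Σ_{a ≤ N} μ(a) log(N/a)/a` (`N ≥ 2`).
RH-FREE [rh-li-prover]: finite-`N` real analysis; nothing here bears on the truth of RH.
-/

noncomputable section

-- D-0017: `Summit.<S>.<S>.…` is the designed namespace of a single-problem summit.
set_option linter.dupNamespace false

open MeasureTheory Set Finset intervalIntegral

namespace Summit.RiemannHypothesis.RiemannHypothesis.Theorems.NbTheory

open Literature.NumberTheory.LFunctions Literature.NumberTheory.LFunctions.BaezDuarteOnlyIf

namespace TailLeverage

/-- On `(1/2, 1]`: `{1/x} = 1/x − 1`. -/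
lemma nbRho_zero_eq {x : ℝ} (hx : x ∈ Set.Ioc (1 / 2 : ℝ) 1) : nbRho 0 x = 1 / x - 1 := by
  obtain ⟨h1, h2⟩ := hx
  have hx0 : 0 < x := by linarith
  unfold nbRho
  simp only [CharP.cast_eq_zero, zero_add, one_mul]
  have hfl : ⌊(1 / x : ℝ)⌋ = 1 := by
    rw [Int.floor_eq_iff]
    constructor
    · push_cast; rw [le_div_iff₀ hx0]; linarith
    · push_cast; rw [div_lt_iff₀ hx0]; linarith
  rw [Int.fract, hfl]
  simp

/-- On `(1/2, 1]`, for `k ≥ 1`: `{1/((k+1)x)} = 1/((k+1)x)`. -/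
lemma nbRho_succ_eq (k : ℕ) (hk : 1 ≤ k) {x : ℝ} (hx : x ∈ Set.Ioc (1 / 2 : ℝ) 1) :
    nbRho k x = 1 / (((k : ℝ) + 1) * x) := by
  obtain ⟨h1, h2⟩ := hx
  have hx0 : 0 < x := by linarith
  have hk' : (1 : ℝ) ≤ k := by exact_mod_cast hk
  unfold nbRho
  rw [Int.fract_eq_self.2 ⟨by positivity, ?_⟩]
  rw [div_lt_one (by positivity)]
  nlinarith

/-- `∫_{1/2}^1 (τ/x − d)² = τ² + d²/2 − 2 τ d log 2`. -/
lemma integral_sq_eq (τ d : ℝ) :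
    ∫ x in (1 / 2 : ℝ)..1, (τ / x - d) ^ 2 = τ ^ 2 + d ^ 2 / 2 - 2 * τ * d * Real.log 2 := by
  have hderiv : ∀ x ∈ uIcc (1 / 2 : ℝ) 1,
      HasDerivAt (fun y : ℝ ↦ -τ ^ 2 * y⁻¹ - 2 * τ * d * Real.log y + d ^ 2 * y) ((τ / x - d) ^ 2) x := by
    intro x hx
    rw [Set.uIcc_of_le (by norm_num)] at hx
    have hx0 : x ≠ 0 := by linarith [hx.1]
    have h1 : HasDerivAt (fun y : ℝ ↦ y⁻¹) (-(x ^ 2)⁻¹) x := hasDerivAt_inv hx0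
    have h2 : HasDerivAt Real.log x⁻¹ x := Real.hasDerivAt_log hx0
    have h := ((h1.const_mul (-τ ^ 2)).sub (h2.const_mul (2 * τ * d))).add ((hasDerivAt_id' x).const_mul (d ^ 2))
    refine h.congr_deriv ?_
    field_simp
    ring
  have hint : IntervalIntegrable (fun x : ℝ ↦ (τ / x - d) ^ 2) volume (1 / 2) 1 := by
    refine (continuousOn_of_forall_continuousAt fun x hx ↦ ?_).intervalIntegrable
    rw [Set.uIcc_of_le (by norm_num)] at hx
    have hx0 : x ≠ 0 := by linarith [hx.1]
    fun_prop (disch := assumption)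
  rw [integral_eq_sub_of_hasDerivAt hderiv hint]
  have hlog : Real.log (1 / 2 : ℝ) = -Real.log 2 := by
    rw [one_div, Real.log_inv]
  simp only [hlog, Real.log_one]
  ring

end TailLeverage

open TailLeverage

/-- **(T1) `NbTailLeverageBound` (RH-FREE per N).**  For every coefficient vector `c : Fin N → ℝ`:
`(1 − 2 log²2)·tailConst(c)² ≤ ∫_{(0,1]} (Σ_k c_k ρ_{k+1})²`. -/
theorem nbTailLeverageBound (N : ℕ) (c : Fin N → ℝ) :
    (1 - 2 * Real.log 2 ^ 2) * tailConst c ^ 2 ≤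
      ∫ x in Ioc (0 : ℝ) 1, (∑ k : Fin N, c k * nbRho k x) ^ 2 := by
  classical
  set τ := tailConst c with hτ
  -- the free constant `d = c_0` (or `0` if `N = 0`)
  set d : ℝ := if h : 0 < N then c ⟨0, h⟩ else 0 with hd
  -- on `(1/2, 1]` the approximant is `τ/x − d`
  have hF : ∀ x ∈ Set.Ioc (1 / 2 : ℝ) 1, ∑ k : Fin N, c k * nbRho k x = τ / x - d := by
    intro x hx
    have hx0 : 0 < x := by linarith [hx.1]
    have hterm : ∀ k : Fin N, c k * nbRho k x =
        c k / (((k : ℕ) : ℝ) + 1) / x - (if (k : ℕ) = 0 then c k else 0) := by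
      intro k
      by_cases hk : (k : ℕ) = 0
      · rw [if_pos hk, hk, nbRho_zero_eq hx]; simp; ring
      · rw [if_neg hk, nbRho_succ_eq k (Nat.one_le_iff_ne_zero.2 hk) hx, sub_zero]; field_simp
    rw [Finset.sum_congr rfl fun k _ ↦ hterm k, Finset.sum_sub_distrib, ← Finset.sum_div]
    have h1 : ∑ k : Fin N, c k / (((k : ℕ) : ℝ) + 1) = τ := by rw [hτ, tailConst]
    have h2 : ∑ k : Fin N, (if (k : ℕ) = 0 then c k else 0) = d := by
      rw [hd]
      split_ifs with hN
      · rw [Finset.sum_ite, Finset.sum_const_zero, add_zero]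
        have : (Finset.univ.filter fun k : Fin N ↦ (k : ℕ) = 0) = {⟨0, hN⟩} := by
          ext k; simp [Fin.ext_iff]
        rw [this, Finset.sum_singleton]
      · have : N = 0 := by omega
        subst this
        simp
    rw [h1, h2]
  -- integrability on `(0,1]` and restriction to `(1/2,1]`
  have hmeas : Measurable fun x ↦ ∑ k : Fin N, c k * nbRho k x :=
    Finset.measurable_sum _ fun k _ ↦ (measurable_nbRho k).const_mul _
  have hbound : ∀ x, |(∑ k : Fin N, c k * nbRho k x) ^ 2| ≤ (∑ k : Fin N, |c k|) ^ 2 := by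
    intro x
    have hFM : |∑ k : Fin N, c k * nbRho k x| ≤ ∑ k : Fin N, |c k| :=
      (Finset.abs_sum_le_sum_abs _ _).trans (Finset.sum_le_sum fun k _ ↦ by
        rw [abs_mul]; exact mul_le_of_le_one_right (abs_nonneg _) (abs_nbRho_le k x))
    rw [abs_pow]
    exact pow_le_pow_left₀ (abs_nonneg _) hFM 2
  have hint : IntegrableOn (fun x ↦ (∑ k : Fin N, c k * nbRho k x) ^ 2) (Set.Ioc (0 : ℝ) 1) :=
    Measure.integrableOn_of_bounded (M := (∑ k : Fin N, |c k|) ^ 2) measure_Ioc_lt_top.ne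
      (hmeas.pow_const 2).aestronglyMeasurable (ae_of_all _ fun x ↦ by rw [Real.norm_eq_abs]; exact hbound x)
  have hsub : Set.Ioc (1 / 2 : ℝ) 1 ⊆ Set.Ioc 0 1 := Set.Ioc_subset_Ioc (by norm_num) le_rfl
  have hmono : ∫ x in Ioc (1 / 2 : ℝ) 1, (∑ k : Fin N, c k * nbRho k x) ^ 2 ≤
      ∫ x in Ioc (0 : ℝ) 1, (∑ k : Fin N, c k * nbRho k x) ^ 2 :=
    setIntegral_mono_set hint (ae_of_all _ fun x ↦ sq_nonneg _) (ae_of_all _ hsub)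
  -- the value on `(1/2,1]`
  have hval : ∫ x in Ioc (1 / 2 : ℝ) 1, (∑ k : Fin N, c k * nbRho k x) ^ 2 =
      τ ^ 2 + d ^ 2 / 2 - 2 * τ * d * Real.log 2 := by
    rw [setIntegral_congr_fun measurableSet_Ioc fun x hx ↦ by rw [hF x hx],
      ← intervalIntegral.integral_of_le (by norm_num : (1 / 2 : ℝ) ≤ 1), integral_sq_eq]
  have hkey : (1 - 2 * Real.log 2 ^ 2) * τ ^ 2 ≤ τ ^ 2 + d ^ 2 / 2 - 2 * τ * d * Real.log 2 := by
    nlinarith [sq_nonneg (2 * τ * Real.log 2 - d)]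
  linarith

/-! ### (T1a) the distance form -/

/-- `d_N²(c)` as a Bochner integral: `nbDistSq N c = ∫_{(0,∞)} g_c²` (`g_c = χ − f_c = approx c`, square-integrable). -/
theorem nbDistSq_eq_integral (N : ℕ) (c : Fin N → ℝ) :
    nbDistSq N c = ∫ x in Ioi (0 : ℝ), approx c x ^ 2 := by
  unfold nbDistSq
  rw [integral_eq_lintegral_of_nonneg_ae (ae_of_all _ fun x ↦ sq_nonneg (approx c x))
    (integrableOn_sq_approx c).aestronglyMeasurable]
  rfl

/-- **(T1a) `NbTailConstLeDist` (RH-FREE per N).**  For every coefficient vector: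
`(2 − 2 log²2)·tailConst(c)² ≤ d_N²(c)` — the `(1,∞)` tail contributes `tailConst(c)²` exactly and the half-interval
`(1/2, 1]`, where `χ − f_c = (1 + c_0) − τ/x`, at least `(1 − 2 log²2)·τ²`. -/
theorem nbTailConstLeDist (N : ℕ) (c : Fin N → ℝ) :
    (2 - 2 * Real.log 2 ^ 2) * tailConst c ^ 2 ≤ nbDistSq N c := by
  classical
  set τ := tailConst c with hτ
  set d : ℝ := if h : 0 < N then c ⟨0, h⟩ else 0 with hd
  have hint := integrableOn_sq_approx c
  -- split `(0,∞) = (0,1] ∪ (1,∞)`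
  have hsplit : ∫ x in Ioi (0 : ℝ), approx c x ^ 2 =
      (∫ x in Ioc (0 : ℝ) 1, approx c x ^ 2) + ∫ x in Ioi (1 : ℝ), approx c x ^ 2 := by
    rw [← Set.Ioc_union_Ioi_eq_Ioi zero_le_one,
      setIntegral_union Set.Ioc_disjoint_Ioi_same measurableSet_Ioi
        (hint.mono_set Set.Ioc_subset_Ioi_self) (hint.mono_set (Set.Ioi_subset_Ioi zero_le_one))]
  -- on `(1/2,1]`: `approx c x = (1 + d) − τ/x`
  have hF : ∀ x ∈ Set.Ioc (1 / 2 : ℝ) 1, approx c x = -(τ / x - (1 + d)) := by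
    intro x hx
    have hx01 : x ∈ Set.Ioc (0 : ℝ) 1 := ⟨by linarith [hx.1], hx.2⟩
    have hsum : ∑ k : Fin N, c k * nbRho k x = τ / x - d := by
      have hterm : ∀ k : Fin N, c k * nbRho k x =
          c k / (((k : ℕ) : ℝ) + 1) / x - (if (k : ℕ) = 0 then c k else 0) := by
        intro k
        by_cases hk : (k : ℕ) = 0
        · rw [if_pos hk, hk, nbRho_zero_eq hx]; simp; ring
        · rw [if_neg hk, nbRho_succ_eq k (Nat.one_le_iff_ne_zero.2 hk) hx, sub_zero]; field_simp
      rw [Finset.sum_congr rfl fun k _ ↦ hterm k, Finset.sum_sub_distrib, ← Finset.sum_div]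
      have h1 : ∑ k : Fin N, c k / (((k : ℕ) : ℝ) + 1) = τ := by rw [hτ, tailConst]
      have h2 : ∑ k : Fin N, (if (k : ℕ) = 0 then c k else 0) = d := by
        rw [hd]
        split_ifs with hN
        · rw [Finset.sum_ite, Finset.sum_const_zero, add_zero]
          have : (Finset.univ.filter fun k : Fin N ↦ (k : ℕ) = 0) = {⟨0, hN⟩} := by
            ext k; simp [Fin.ext_iff]
          rw [this, Finset.sum_singleton]
        · have : N = 0 := by omega
          subst this
          simp
      rw [h1, h2]
    have hsum' : ∑ k : Fin N, c k * Int.fract (1 / (((k : ℕ) + 1 : ℝ) * x)) = τ / x - d := by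
      rw [← hsum]; rfl
    rw [approx, Set.indicator_of_mem hx01, hsum']
    simp only [Pi.one_apply]
    ring
  have hhalf : (1 - 2 * Real.log 2 ^ 2) * τ ^ 2 ≤ ∫ x in Ioc (0 : ℝ) 1, approx c x ^ 2 := by
    have hsub : Set.Ioc (1 / 2 : ℝ) 1 ⊆ Set.Ioc 0 1 := Set.Ioc_subset_Ioc (by norm_num) le_rfl
    have hmono : ∫ x in Ioc (1 / 2 : ℝ) 1, approx c x ^ 2 ≤ ∫ x in Ioc (0 : ℝ) 1, approx c x ^ 2 :=
      setIntegral_mono_set (hint.mono_set Set.Ioc_subset_Ioi_self) (ae_of_all _ fun x ↦ sq_nonneg _)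
        (ae_of_all _ hsub)
    have hval : ∫ x in Ioc (1 / 2 : ℝ) 1, approx c x ^ 2 = τ ^ 2 + (1 + d) ^ 2 / 2 - 2 * τ * (1 + d) * Real.log 2 := by
      rw [setIntegral_congr_fun measurableSet_Ioc fun x hx ↦ by rw [hF x hx, neg_sq],
        ← intervalIntegral.integral_of_le (by norm_num : (1 / 2 : ℝ) ≤ 1), integral_sq_eq]
    have hkey : (1 - 2 * Real.log 2 ^ 2) * τ ^ 2 ≤ τ ^ 2 + (1 + d) ^ 2 / 2 - 2 * τ * (1 + d) * Real.log 2 := by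
      nlinarith [sq_nonneg (2 * τ * Real.log 2 - (1 + d))]
    linarith
  rw [nbDistSq_eq_integral, hsplit, integral_Ioi_one_sq_approx]
  linarith

/-! ### The Levinson vector's tail constant (T6a) -/

/-- **(T6a) `NbLevinsonTailConst` (RH-FREE).**  `tailConst(v_N) = −(1/log N) Σ_k μ(k+1) log(N/(k+1))/(k+1)`, `N ≥ 2`. -/
theorem nbLevinsonTailConst (N : ℕ) (hN : 2 ≤ N) :
    tailConst (nbLevinsonVector N) =
      -(1 / Real.log N) * ∑ k : Fin N,
        (ArithmeticFunction.moebius (k.val + 1) : ℝ) * Real.log ((N : ℝ) / ((k.val : ℝ) + 1)) /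
          ((k.val : ℝ) + 1) := by
  have hN' : (2 : ℝ) ≤ N := by exact_mod_cast hN
  have hlog : Real.log N ≠ 0 := by
    have : 0 < Real.log (N : ℝ) := Real.log_pos (by linarith)
    exact this.ne'
  unfold tailConst nbLevinsonVector
  rw [Finset.mul_sum]
  refine Finset.sum_congr rfl fun k _ ↦ ?_
  have hk : (0 : ℝ) < (k.val : ℝ) + 1 := by positivity
  rw [Real.log_div (by positivity) hk.ne']
  field_simp

end Summit.RiemannHypothesis.RiemannHypothesis.Theorems.NbTheory

end
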